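import Literature.AnabelianGeometry.EtaleTheta.Thm16SubdagStatements
import Literature.AnabelianGeometry.EtaleTheta.SettingGaloisFacts
import HarnessLib

/-!
# [EtTh] §1 p. 13: `G_{K_N} = Gal(K̄/K(ζ_N, q_X^{1/N}))` unfolded — an element of `G_{ℚ_p}` lies in
# `G_{K_N}` iff it fixes `K`, the `N`-th roots of unity and the `N`-th roots of `q_X`; hence the
# KUMMER-THEORETIC form of the p. 13 characterisation `GKNIsKernelOfAction`

Mochizuki, *The étale theta function …*, Publ. RIMS **45** (2009), §1 p. 13: "`K_N := K(ζ_N, q_X^{1/N})`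
… Then any decomposition group of a cusp of `Y^log` determines … an open immersion
`G_{K_N} ↪ (Π^tp_Y)^ell/N·(Δ^tp_Y)^ell` … [Indeed, this follows from the fact that `G_{K_N}` acts trivially
on `(Δ^tp_X)^ell/N·(Δ^tp_Y)^ell`.]" [cite: MochizukiEtTh2009, §1 p.13].

abc-iut cell, layer L2, sub-DAG `plan/L2/SUBDAG-EtTh-Thm16.md` leaf L04 (seat abc-iut-w5-d051; companion
of `Discharge/Sec1Thm16GKN.lean`). The root `ThetaSetting` (abc-iut-L2-t1, `Setting.lean`) DEFINES
`G_{K_N}` field-theoretically as the fixing subgroup of `fieldKN K q_X N = ℚ_p(K ∪ {x | x^N = 1 ∨ x^N = q_X})`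
inside `G_{ℚ_p} = Gal(ℚ̄_p/ℚ_p)`. PROVED here (theorems only, plain Galois theory over Mathlib):

* (private) `mem_fixingSubgroup_adjoin_iff` — `σ ∈ Gal(E/F)` fixes `F(S)` pointwise iff it fixes `S`;
* `Thm16Sub.mem_GKN_iff` — `σ ∈ G_{K_N} ↔ σ ∈ G_K ∧ σ` fixes every `N`-th root of unity `∧ σ` fixes every
  `N`-th root of `q_X` (print's "`K_N = K(ζ_N, q_X^{1/N})`", with no choice of `ζ_N` or of the root;
  cf. abc-iut-L2-t1's `ThetaSetting.GKN_le_GK` / `GKN_one`, `SettingGaloisFacts.lean`); `Thm16Sub.aug_mem_GKN_iff`;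
* **`Thm16Sub.gknIsKernelOfAction_iff_kummer`** — the named statement `GKNIsKernelOfAction D N` of
  abc-iut-L6-d5's `Thm16SubdagStatements.lean` (the p. 13 bracket, a HYPOTHESIS of Thm. 1.6 (i)'s
  assembly at `N = 2`, GAP-LEDGER G-w5d051-1) is EQUIVALENT to the concrete Kummer-theoretic statement:
  for every `g ∈ Π^tp_X`, "`aug(g)` fixes `μ_N(K̄)` and the `N`-th roots of `q_X`" iff "conjugation by `g`
  acts trivially on `(Δ^tp_X)^ell` modulo `N·(Δ^tp_Y)^ell`". This is the exact shape in which the missing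
  transcription (the `G_K`-module `(Δ^tp_X)^ell/N·(Δ^tp_Y)^ell ≅` the extension of `ℤ` by `μ_N` classified by
  the Kummer class of `q_X`, Tate uniformisation) would discharge it.

HONEST FRAMING: [EtTh] is refereed and undisputed; nothing is asserted; typed ≠ proved; nothing here
bears on [IUTchIII] Cor. 3.12.
-/

noncomputable section

namespace Literature.AnabelianGeometry.EtaleTheta

open Literature.AnabelianGeometry.SemiGraphs

namespace Thm16Sub

/-! ### Galois theory: the fixing subgroup of `F(S)` -/

/-- An `F`-automorphism of `E` fixes `F(S)` pointwise iff it fixes `S` pointwise (private Galois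
plumbing for `mem_GKN_iff`). [folklore] -/
private theorem mem_fixingSubgroup_adjoin_iff {F E : Type*} [Field F] [Field E] [Algebra F E] (S : Set E)
    (σ : E ≃ₐ[F] E) :
    σ ∈ (IntermediateField.adjoin F S).fixingSubgroup ↔ ∀ x ∈ S, σ x = x := by
  rw [IntermediateField.mem_fixingSubgroup_iff]
  constructor
  · intro h x hx
    exact h x (IntermediateField.subset_adjoin F S hx)
  · intro h x hx
    -- `F(S) ≤ Fix(⟨σ⟩)`
    have hle : IntermediateField.adjoin F S ≤ IntermediateField.fixedField (Subgroup.zpowers σ) := by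
      rw [IntermediateField.adjoin_le_iff]
      intro y hy
      rw [SetLike.mem_coe, IntermediateField.mem_fixedField_iff]
      intro f hf
      have hσ : σ ∈ MulAction.stabilizer (E ≃ₐ[F] E) y := by
        rw [MulAction.mem_stabilizer_iff, AlgEquiv.smul_def]
        exact h y hy
      have hf' : f ∈ MulAction.stabilizer (E ≃ₐ[F] E) y := (Subgroup.zpowers_le.mpr hσ) hf
      rw [MulAction.mem_stabilizer_iff, AlgEquiv.smul_def] at hf'
      exact hf'
    have hx' := hle hx
    rw [IntermediateField.mem_fixedField_iff] at hx'
    exact hx' σ (Subgroup.mem_zpowers σ)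

/-! ### `G_{K_N}` unfolded -/

variable {p : ℕ} [Fact p.Prime] (D : ThetaSetting p)

/-- **`G_{K_N} = Gal(K̄/K(ζ_N, q_X^{1/N}))` unfolded** (p. 13): `σ ∈ G_{ℚ_p}` lies in `G_{K_N}` iff it fixes
`K` pointwise, fixes every `N`-th root of unity of `K̄ = ℚ̄_p`, and fixes every `N`-th root of `q_X`.
[cite: MochizukiEtTh2009, §1 p.13] -/
theorem mem_GKN_iff (N : ℕ+) (σ : GQp p) :
    σ ∈ D.GKN N ↔ σ ∈ D.GK ∧ (∀ ζ : PadicAlgCl p, ζ ^ (N : ℕ) = 1 → σ ζ = ζ) ∧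
      ∀ r : PadicAlgCl p, r ^ (N : ℕ) = D.qX → σ r = r := by
  change σ ∈ (fieldKN D.K D.qX N).fixingSubgroup ↔ σ ∈ D.K.fixingSubgroup ∧ _
  rw [fieldKN, mem_fixingSubgroup_adjoin_iff, IntermediateField.mem_fixingSubgroup_iff]
  constructor
  · intro h
    refine ⟨fun x hx => h x (Or.inl hx), fun ζ hζ => h ζ (Or.inr (Or.inl hζ)),
      fun r hr => h r (Or.inr (Or.inr hr))⟩
  · rintro ⟨hK, hζ, hr⟩ x (hx | hx | hx)
    · exact hK x hx
    · exact hζ x hx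
    · exact hr x hx

/-- For `g ∈ Π^tp_X`: `aug(g) ∈ G_{K_N}` iff `aug(g)` fixes the `N`-th roots of unity and the `N`-th roots
of `q_X` (`aug(g) ∈ G_K` automatically, `range_aug`). [cite: MochizukiEtTh2009, §1 p.13] -/
theorem aug_mem_GKN_iff (N : ℕ+) (g : D.PiTemp) :
    D.aug g ∈ D.GKN N ↔ (∀ ζ : PadicAlgCl p, ζ ^ (N : ℕ) = 1 → D.aug g ζ = ζ) ∧
      ∀ r : PadicAlgCl p, r ^ (N : ℕ) = D.qX → D.aug g r = r := by
  have hg : D.aug g ∈ D.GK := by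
    change D.aug g ∈ D.K.fixingSubgroup
    rw [← D.range_aug]
    exact ⟨g, rfl⟩
  rw [mem_GKN_iff]
  exact ⟨fun h => h.2, fun h => ⟨hg, h⟩⟩

/-- **The p. 13 characterisation in Kummer-theoretic form.** `GKNIsKernelOfAction D N` (abc-iut-L6-d5,
the hypothesis of Thm. 1.6 (i)'s assembly at `N = 2`) is equivalent to: for every `g ∈ Π^tp_X`, `aug(g)`
fixes `μ_N(K̄)` and the `N`-th roots of `q_X` iff conjugation by `g` acts trivially on `(Δ^tp_X)^ell`
modulo `N·(Δ^tp_Y)^ell` — the statement the Tate-uniformisation description of the `G_K`-module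
`(Δ^tp_X)^ell/N·(Δ^tp_Y)^ell` (extension of `ℤ` by `μ_N` with class the Kummer class of `q_X`) would prove.
[cite: MochizukiEtTh2009, §1 p.13] -/
theorem gknIsKernelOfAction_iff_kummer (N : ℕ+) :
    GKNIsKernelOfAction D N ↔ ∀ g : D.PiTemp,
      ((∀ ζ : PadicAlgCl p, ζ ^ (N : ℕ) = 1 → D.aug g ζ = ζ) ∧
          ∀ r : PadicAlgCl p, r ^ (N : ℕ) = D.qX → D.aug g r = r) ↔
        ∀ x ∈ D.DeltaTemp, toEll D (g * x * g⁻¹ * x⁻¹) ∈ ellPowersY D N := by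
  refine forall_congr' fun g => ?_
  rw [aug_mem_GKN_iff D N g]

end Thm16Sub

end Literature.AnabelianGeometry.EtaleTheta

end
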